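/-
Origin: expansion seat `planner-pub-hodgecm-pv12-g7-0`, handover #7 2026-08-18T10:23:11Z (`HOME/pub-hodgecm-pv12-g7/lean/Pv12g7/FockPrintKinds.lean`, md5 98b61422, 190 lines);
landed by the gen-7 packager in gate run 28 as `HodgeCM/PerL34/FockPrintKinds.lean` (import ^import Pv[0-9]+g[0-9]+\.→import HodgeCM.PerL34. ×1).
-/
/-
Copyright (c) 2026. Released under the Apache-2.0 license.
-/
import Summits.HodgeConjecture.HodgeCM.PerL34.FockPrintPlaces

/-!
# The place types as a FUNCTION of the printed sign data (`kindOfSigns`; adv2g23-X49)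

Origin: expansion seat `planner-pub-hodgecm-pv12-g7-0` (unit `pub-hodgecm-pv12-g7`, DAG-node prover #12 gen 7, the
Fock-model seat).  WIP module `Pv12g7.FockPrintKinds`; intended final place `HodgeCM/PerL34/FockPrintKinds.lean` with the
single import `HodgeCM.PerL34.FockPrintPlaces` (pv12-g7 #3, RUN 28; rewrite `^import Pv12g7\.` ↦ `import HodgeCM.PerL34.`).

WHAT THIS FILE DOES.  `FockPrintPlaces.printPlaces RP kind lam hlam vac` takes the place type `kind : RP → PlaceKind` as a
FREE parameter (adv2g23-X49: "nothing in the kernel ties `kind b` to the forced signs … nor requires exactly one `iota`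
place").  PerL v5 Lemma 3.3(b) (tex ll. 285–286, quoted): "For allowed pairs, `W₁ ⊕ W₂` and `W₃ ⊕ W₄` have the same signature
at every real place: `(2,0)` resp. `(0,2)` (sign `ε_hol`) at `ι₁`, definite at the set `D₁₂` of `b ≠ ι₁` with
`m_b(Ψ₁) = m_b(Ψ₂)`, and `(1,1)` at the non-empty set `Σ₁₂` of `b` with `m_b(Ψ₁) ≠ m_b(Ψ₂)`."  This is a DEFINITION of the
partition `RP = {ι₁} ⊔ D₁₂ ⊔ Σ₁₂` from the pair of sign vectors `(m(Ψ₁), m(Ψ₂))`; we type it: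

* `kindOfSigns ι m₁ m₂ b := iota` if `b = ι`, else `delta` if `m₁ b = m₂ b`, else `sigma` — over ANY sign alphabet `S` with
  decidable equality (PerL: `S = {±1}`; prl1-g5's `SignRecipe`: `Bool`), since only the equality `m₁ b = m₂ b` matters;
* the characterisations `kindOfSigns_eq_iota_iff / _eq_delta_iff / _eq_sigma_iff`, EXACTLY ONE place of kind `ι₁`
  (`filter_kindOfSigns_iota`, `card_kindOfSigns_iota`), `Σ₁₂ ≠ ∅ ↔ the sign vectors differ off ι₁`
  (`exists_kindOfSigns_sigma_iff`; PerL's "non-empty" is the INPUT `Ψ₁|… ≠ Ψ₂|…`, l. 289, not proved here), invariance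
  under relabelling the alphabet (`kindOfSigns_comp_injective`: e.g. `m ↦ −m`, the complex-conjugate recipe) and under
  swapping the two lines (`kindOfSigns_swap`);
* `printPlacesOfSigns RP ι m₁ m₂ lam hlam vac := printPlaces RP (kindOfSigns ι m₁ m₂) lam hlam vac` with the local data
  RESOLVED by the signs: `…_loc_self` (at `ι₁`: the `(2,1)`-model `ofPrintICircle`), `…_loc_of_eq` (`D₁₂`: `ofPrintECircle`),
  `…_loc_of_ne` (`Σ₁₂`: `ofPrintMCircle`).

So a consumer holding PerL's sign data (or prl1-g5's `SignRecipe` read at the place representatives) supplies `kind` BY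
NAME as `kindOfSigns ι₁ (m · Ψ₁) (m · Ψ₂)`; `vac` and `lam` remain consumer data (D5 / Adams's `ψ`), the `ι₁`-vacuum being
constrained by `FockPrintTwist` / `FockPrintConjPlane` (`kappaReachable_iff_of_data`).  No statement of PerL is cited as a
fact; hypothesis-free; axioms: the Lean trio only.
-/

namespace HodgeCM.PerL34.Fock

noncomputable section

namespace PrintDict

/-! ## 1. The partition of the real places from two sign vectors -/

section Kinds

variable {RP : Type} [DecidableEq RP] {S : Type} [DecidableEq S]

/-- **PerL's place types from the sign data** (Lemma 3.3(b), ll. 285–286): `ι₁ ↦ iota`; for `b ≠ ι₁`, `delta` (`b ∈ D₁₂`)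
iff `m_b(Ψ₁) = m_b(Ψ₂)`, `sigma` (`b ∈ Σ₁₂`) iff `m_b(Ψ₁) ≠ m_b(Ψ₂)`. -/
def kindOfSigns (ι : RP) (m₁ m₂ : RP → S) (b : RP) : PlaceKind :=
  if b = ι then PlaceKind.iota else if m₁ b = m₂ b then PlaceKind.delta else PlaceKind.sigma

variable (ι : RP) (m₁ m₂ : RP → S)

/-- (Ported verbatim from the HodgeCMPerL package; no docstring in the source.) -/
@[simp] theorem kindOfSigns_self : kindOfSigns ι m₁ m₂ ι = PlaceKind.iota := by
  simp [kindOfSigns]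

/-- (Ported verbatim from the HodgeCMPerL package; no docstring in the source.) -/
theorem kindOfSigns_of_ne_of_eq {b : RP} (hb : b ≠ ι) (h : m₁ b = m₂ b) : kindOfSigns ι m₁ m₂ b = PlaceKind.delta := by
  simp [kindOfSigns, hb, h]

/-- (Ported verbatim from the HodgeCMPerL package; no docstring in the source.) -/
theorem kindOfSigns_of_ne_of_ne {b : RP} (hb : b ≠ ι) (h : m₁ b ≠ m₂ b) : kindOfSigns ι m₁ m₂ b = PlaceKind.sigma := by
  simp [kindOfSigns, hb, h]

/-- (Ported verbatim from the HodgeCMPerL package; no docstring in the source.) -/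
theorem kindOfSigns_eq_iota_iff {b : RP} : kindOfSigns ι m₁ m₂ b = PlaceKind.iota ↔ b = ι := by
  unfold kindOfSigns
  split_ifs <;> simp_all

/-- (Ported verbatim from the HodgeCMPerL package; no docstring in the source.) -/
theorem kindOfSigns_eq_delta_iff {b : RP} : kindOfSigns ι m₁ m₂ b = PlaceKind.delta ↔ b ≠ ι ∧ m₁ b = m₂ b := by
  unfold kindOfSigns
  split_ifs <;> simp_all

/-- (Ported verbatim from the HodgeCMPerL package; no docstring in the source.) -/
theorem kindOfSigns_eq_sigma_iff {b : RP} : kindOfSigns ι m₁ m₂ b = PlaceKind.sigma ↔ b ≠ ι ∧ m₁ b ≠ m₂ b := by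
  unfold kindOfSigns
  split_ifs <;> simp_all

/-- (Ported verbatim from the HodgeCMPerL package; no docstring in the source.) -/
theorem kindOfSigns_ne_iota {b : RP} (hb : b ≠ ι) : kindOfSigns ι m₁ m₂ b ≠ PlaceKind.iota := by
  rw [Ne, kindOfSigns_eq_iota_iff]
  exact hb

/-- EXACTLY ONE place of kind `ι₁` (KERNEL; adv2g23-X49 "nor requires exactly one `iota` place"). -/
theorem filter_kindOfSigns_iota [Fintype RP] :
    (Finset.univ.filter fun b => kindOfSigns ι m₁ m₂ b = PlaceKind.iota) = {ι} := by
  ext b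
  simp [kindOfSigns_eq_iota_iff]

/-- (Ported verbatim from the HodgeCMPerL package; no docstring in the source.) -/
theorem card_kindOfSigns_iota [Fintype RP] :
    (Finset.univ.filter fun b => kindOfSigns ι m₁ m₂ b = PlaceKind.iota).card = 1 := by
  rw [filter_kindOfSigns_iota, Finset.card_singleton]

/-- (Ported verbatim from the HodgeCMPerL package; no docstring in the source.) -/
theorem existsUnique_kindOfSigns_iota : ∃! b, kindOfSigns ι m₁ m₂ b = PlaceKind.iota :=
  ⟨ι, kindOfSigns_self ι m₁ m₂, fun _ hb => (kindOfSigns_eq_iota_iff ι m₁ m₂).mp hb⟩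

/-- `Σ₁₂ ≠ ∅` iff the two sign vectors differ at some place other than `ι₁` (KERNEL; PerL's "non-empty set `Σ₁₂`",
l. 286, is thus the INPUT `m(Ψ₁) ≠ m(Ψ₂)` off `ι₁`, l. 289). -/
theorem exists_kindOfSigns_sigma_iff : (∃ b, kindOfSigns ι m₁ m₂ b = PlaceKind.sigma) ↔ ∃ b, b ≠ ι ∧ m₁ b ≠ m₂ b := by
  simp [kindOfSigns_eq_sigma_iff]

/-- `D₁₂ ∪ Σ₁₂ = RP ∖ {ι₁}` (KERNEL). -/
theorem kindOfSigns_eq_delta_or_sigma_iff {b : RP} :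
    (kindOfSigns ι m₁ m₂ b = PlaceKind.delta ∨ kindOfSigns ι m₁ m₂ b = PlaceKind.sigma) ↔ b ≠ ι := by
  rw [kindOfSigns_eq_delta_iff, kindOfSigns_eq_sigma_iff]
  constructor
  · rintro (⟨hb, -⟩ | ⟨hb, -⟩) <;> exact hb
  · intro hb
    by_cases h : m₁ b = m₂ b
    · exact Or.inl ⟨hb, h⟩
    · exact Or.inr ⟨hb, h⟩

/-- Relabelling the sign alphabet injectively (e.g. `m ↦ −m`: the complex-conjugate recipe) does not change the types
(KERNEL). -/
theorem kindOfSigns_comp_injective {S' : Type} [DecidableEq S'] (g : S → S') (hg : Function.Injective g) :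
    kindOfSigns ι (g ∘ m₁) (g ∘ m₂) = kindOfSigns ι m₁ m₂ := by
  funext b
  simp [kindOfSigns, hg.eq_iff]

/-- Swapping the two lines does not change the types (KERNEL). -/
theorem kindOfSigns_swap : kindOfSigns ι m₂ m₁ = kindOfSigns ι m₁ m₂ := by
  funext b
  simp [kindOfSigns, eq_comm]

/-- Equal sign vectors: every place other than `ι₁` is in `D₁₂` (KERNEL; the excluded case `Ψ₁ = Ψ₂` of PerL). -/
theorem kindOfSigns_self_right {b : RP} (hb : b ≠ ι) : kindOfSigns ι m₁ m₁ b = PlaceKind.delta :=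
  kindOfSigns_of_ne_of_eq ι m₁ m₁ hb rfl

end Kinds

/-! ## 2. The printed `FockPlaces` with the types supplied by the signs -/

section PlacesOfSigns

variable (RP : Type) [Fintype RP] [DecidableEq RP] {S : Type} [DecidableEq S] (ι : RP) (m₁ m₂ : RP → S)
  (lam : RP → ℂ) (hlam : ∀ b, lam b ≠ 0) (vac : RP → (Circle × Circle →* Circle))

/-- **PerL Lemma 4.1's `FockPlaces` FROM PRINT with the place types READ OFF THE SIGN DATA** (X45 + X49):
`printPlaces` with `kind := kindOfSigns ι₁ m(Ψ₁) m(Ψ₂)`. -/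
noncomputable def printPlacesOfSigns : FockPlaces :=
  printPlaces RP (kindOfSigns ι m₁ m₂) lam hlam vac

/-- (Ported verbatim from the HodgeCMPerL package; no docstring in the source.) -/
theorem printPlacesOfSigns_eq :
    printPlacesOfSigns RP ι m₁ m₂ lam hlam vac = printPlaces RP (kindOfSigns ι m₁ m₂) lam hlam vac := rfl

/-- (Ported verbatim from the HodgeCMPerL package; no docstring in the source.) -/
theorem printPlacesOfSigns_loc (b : RP) :
    (printPlacesOfSigns RP ι m₁ m₂ lam hlam vac).loc b = printLoc (lam b) (hlam b) (vac b) (kindOfSigns ι m₁ m₂ b) := rfl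

/-- At `ι₁` the local datum is the signature-`(2,1)` model `ofPrintICircle` (κ-part `ℂ·det z`). -/
theorem printPlacesOfSigns_loc_self :
    (printPlacesOfSigns RP ι m₁ m₂ lam hlam vac).loc ι = printLoc (lam ι) (hlam ι) (vac ι) PlaceKind.iota := by
  rw [printPlacesOfSigns_loc, kindOfSigns_self]

/-- On `D₁₂` the local datum is the all-definite model `ofPrintECircle` (κ-part `ℂ·1`). -/
theorem printPlacesOfSigns_loc_of_eq {b : RP} (hb : b ≠ ι) (h : m₁ b = m₂ b) :
    (printPlacesOfSigns RP ι m₁ m₂ lam hlam vac).loc b = printLoc (lam b) (hlam b) (vac b) PlaceKind.delta := by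
  rw [printPlacesOfSigns_loc, kindOfSigns_of_ne_of_eq ι m₁ m₂ hb h]

/-- On `Σ₁₂` the local datum is the mixed model `ofPrintMCircle` (κ-part `ℂ[P]`). -/
theorem printPlacesOfSigns_loc_of_ne {b : RP} (hb : b ≠ ι) (h : m₁ b ≠ m₂ b) :
    (printPlacesOfSigns RP ι m₁ m₂ lam hlam vac).loc b = printLoc (lam b) (hlam b) (vac b) PlaceKind.sigma := by
  rw [printPlacesOfSigns_loc, kindOfSigns_of_ne_of_ne ι m₁ m₂ hb h]

/-- The global vacuum character and its properties are those of `printPlaces` (by `rfl`). -/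
theorem printPlacesOfSigns_χ_one : ∀ b : RP, ((printPlacesOfSigns RP ι m₁ m₂ lam hlam vac).loc b).χ 1 = 1 :=
  printPlaces_χ_one RP (kindOfSigns ι m₁ m₂) lam hlam vac

/-- (Ported verbatim from the HodgeCMPerL package; no docstring in the source.) -/
theorem printPlacesOfSigns_norm_χ :
    ∀ (b : RP) (s : ((printPlacesOfSigns RP ι m₁ m₂ lam hlam vac).loc b).T),
      ‖((printPlacesOfSigns RP ι m₁ m₂ lam hlam vac).loc b).χ s‖ = 1 :=
  printPlaces_norm_χ RP (kindOfSigns ι m₁ m₂) lam hlam vac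

end PlacesOfSigns

/-! ## 3. Smoke test: three places, signs `(+,+,−)` vs `(+,−,−)` with `ι₁ = 0` -/

section Smoke

/-- (Ported verbatim from the HodgeCMPerL package; no docstring in the source.) -/
private def mA : Fin 3 → Bool := ![true, true, false]
/-- (Ported verbatim from the HodgeCMPerL package; no docstring in the source.) -/
private def mB : Fin 3 → Bool := ![true, false, false]

example : kindOfSigns (0 : Fin 3) mA mB 0 = PlaceKind.iota := by decide
example : kindOfSigns (0 : Fin 3) mA mB 1 = PlaceKind.sigma := by decide
example : kindOfSigns (0 : Fin 3) mA mB 2 = PlaceKind.delta := by decide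
example : (Finset.univ.filter fun b => kindOfSigns (0 : Fin 3) mA mB b = PlaceKind.sigma).card = 1 := by decide

end Smoke

end PrintDict

end

end HodgeCM.PerL34.Fock
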